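import Mathlib
import Summits.ResolutionOfSingularities.ResolutionOfSingularities.Theorems.HomologicalConductorNoZenoReflexiveHullLocalization
import Literature.RingTheory.IntegralClosure.KrullIntersection
import HarnessLib

/-!
# [OURS · L1 w44b] K-PCC sheaf half, FILE 4a: a height-one prime of a noetherian normal domain is a
# REFLEXIVE module (divisorial ideal)

Rung S-2 `HomologicalConductor.PersistenceSurface` (stmt-ResolutionOfSingularities-19970), route
`ResolutionOfSingularities/HomologicalConductor`, chain W4.4b (cell res-hironaka), WAVE-3 row «stub-3 → K-PCC
SHEAF HALF». `[OURS · L1 w44b]` textbook commutative algebra (Bourbaki, *Alg. Comm.* VII §1; Bruns–Herzog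
Prop. 1.4.1), assembled from the W4.4 reflexive-hull package (`NoZeno.SandwichCluster.reflexiveHull`,
`reflexiveHullToDoubleDual_bijective`, `exists_smul_mem_of_mem_reflexiveHull_of_height_le_one`) and the tree's
Krull intersection `R = ⋂_{ht P = 1} R_P`; replaces the role of no printed item; NOT a statement of the manuscript
under review; AI-written, weaker than expert review.

Use (FILE 4b): in K-PCC Thm 2.3 the module `M_{−δ_t} = H⁰(X ∖ E, 𝒪_X(−Γ_t))` of a curvette `Γ_t` IS the
height-one prime `𝔭_t ⊂ T` of the curve germ `π(Γ_t)`; the rank-one ceiling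
`ca³(T) ⊆ 𝔭·𝔭⁻¹` (lead-1 p553024 `algebraMap_mem_mul_inv_of_isReflexive`) needs `𝔭` reflexive.

* `isReflexive_map_of_height_eq_one` / **`isReflexive_of_height_eq_one`** — for a prime `P` of height one in
  a noetherian integrally closed domain `S`, the `S`-module `P` is reflexive: its reflexive hull inside
  `K = Frac S` agrees with `P` at every height-one prime, so a vector of the hull lies in `⋂_Q S_Q = S` and,
  testing at `Q = P`, in `P`.

References: W. Bruns, J. Herzog, *Cohen–Macaulay rings* (1998), Prop. 1.4.1 [`BrunsHerzog1998`];
H. Matsumura, *Commutative Ring Theory* (1986), Thm. 11.5 [`Matsumura1987`].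
-/

set_option linter.dupNamespace false
set_option autoImplicit false

noncomputable section

open Module IsLocalRing
open Summit.ResolutionOfSingularities.ResolutionOfSingularities.Theorems.NoZeno.SandwichCluster

universe u

namespace Summit.ResolutionOfSingularities.ResolutionOfSingularities.Theorems.HomologicalConductor.PersistencePointedCeiling

variable {S : Type u} [CommRing S] [IsDomain S] [IsNoetherianRing S] [IsIntegrallyClosed S]

/-- **The image in `Frac S` of a height-one prime is its own reflexive hull, hence reflexive.** For `P` a
height-one prime of a noetherian integrally closed domain `S` and `N = P ⊆ K = Frac S`: `hull N = N` (a vector of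
the hull has, for each height-one `Q`, a multiple by some `u ∉ Q` in `N ⊆ S`; so it lies in `S` by Krull's
intersection theorem, and in `P` by primality at `Q = P`), and `hull N ≅ N**` compatibly with `Dual.eval`.
[cite: BrunsHerzog1998, Prop. 1.4.1] -/
theorem isReflexive_map_of_height_eq_one (P : Ideal S) [hP : P.IsPrime] (h1 : P.height = 1) :
    Module.IsReflexive S ↥(Submodule.map (Algebra.linearMap S (FractionRing S)) P) := by
  classical
  set K := FractionRing S
  set N : Submodule S K := Submodule.map (Algebra.linearMap S K) P with hNdef
  have hinj : Function.Injective (algebraMap S K) := IsFractionRing.injective S K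
  haveI : NoZeroSMulDivisors S K := by
    refine (noZeroSMulDivisors_iff_right_eq_zero_of_smul).mpr fun r hr m hm => ?_
    rw [Algebra.smul_def] at hm
    exact (mul_eq_zero.mp hm).resolve_left fun h0 => hr (hinj (by rw [h0, map_zero]))
  haveI : Module.Finite S N := inferInstance
  -- the hull is `N`
  have hhull : reflexiveHull N = N := by
    refine le_antisymm (fun w hw => ?_) (le_reflexiveHull N)
    -- at every height-one prime `Q`, `u • w ∈ N` for some `u ∉ Q`
    have key : ∀ Q : Ideal S, Q.IsPrime → Q.height = 1 →
        ∃ u ∉ Q, ∃ a ∈ P, algebraMap S K u * w = algebraMap S K a := by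
      intro Q hQ hQ1
      haveI := hQ
      obtain ⟨u, huQ, huw⟩ := exists_smul_mem_of_mem_reflexiveHull_of_height_le_one Q hQ1.le N hw
      obtain ⟨a, haP, ha⟩ := Submodule.mem_map.mp huw
      exact ⟨u, huQ, a, haP, by rw [← Algebra.smul_def, ← ha]; rfl⟩
    -- hence `w ∈ S`
    obtain ⟨t, ht⟩ := Literature.RingTheory.IntegralClosure.exists_algebraMap_eq_of_forall_height_eq_one
      (R := S) (K := K) w fun Q hQ hQ1 => by
        obtain ⟨u, huQ, a, -, ha⟩ := key Q hQ hQ1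
        exact ⟨u, huQ, a, ha⟩
    -- and `t ∈ P`, testing at `Q = P`
    obtain ⟨u, huP, a, haP, ha⟩ := key P hP h1
    rw [← ht, ← map_mul] at ha
    have hut : u * t ∈ P := by rw [hinj ha]; exact haP
    have htP : t ∈ P := (hP.mem_or_mem hut).resolve_left huP
    exact Submodule.mem_map.mpr ⟨t, htP, ht⟩
  -- `Dual.eval = (hull N ≅ N**) ∘ (N = hull N)`
  refine ⟨?_⟩
  have hbij := reflexiveHullToDoubleDual_bijective (K := K) N
  have hincl : Function.Bijective (Submodule.inclusion (le_reflexiveHull N)) := by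
    refine ⟨Submodule.inclusion_injective _, fun w => ?_⟩
    obtain ⟨v, hv⟩ := w
    have hw : v ∈ N := hhull.le hv
    exact ⟨⟨v, hw⟩, rfl⟩
  have h := hbij.comp hincl
  rwa [← LinearMap.coe_comp, reflexiveHullToDoubleDual_comp_inclusion] at h

/-- **A height-one prime of a noetherian normal domain is a reflexive module** (a divisorial ideal).
[cite: BrunsHerzog1998, Prop. 1.4.1] -/
theorem isReflexive_of_height_eq_one (P : Ideal S) [P.IsPrime] (h1 : P.height = 1) :
    Module.IsReflexive S ↥P := by
  haveI := isReflexive_map_of_height_eq_one P h1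
  exact Module.equiv (Submodule.equivMapOfInjective (Algebra.linearMap S (FractionRing S))
    (IsFractionRing.injective S (FractionRing S)) P).symm

end Summit.ResolutionOfSingularities.ResolutionOfSingularities.Theorems.HomologicalConductor.PersistencePointedCeiling

end
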